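import Summits.HubbardSuperconductivity.HubbardSuperconductivity.Theorems.LevyLogBootstrapDressHalfFilledKernelSymmetry
import Literature.MathematicalPhysics.QuantumLattice.InterClusterKernelSelectionRules
import HarnessLib

/-!
# Crux `DressHalfFilled` (stmt-HubbardSuperconductivity-8148, route `LevyLogBootstrap`; shared with route
# `AnisotropyChord` and, for stubs 1–2, with crux stmt-10291 `DressAnyFilling`): THE FULL `4 × 4` STRUCTURE OF KATO'S
# TWO-PLAQUETTE KERNEL — the two-plaquette form of the hard-core boson dictionary

Support file (`--supports stmt-HubbardSuperconductivity-8148`) for stub 2 (`stub_plaquetteDictionary`, clause (d):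
`T S(E₀) T = -(2J · xxzHamiltonian 1 (torusGraph 2 M) (-1) Δ_eff + k(N_b))`) of the line
`Cruxes/DressHalfFilled/Lines/birth.lean`. On ONE superlattice bond the dictionary says that the `4 × 4` matrix
`K = plaquetteKernel U` of `⟨κ'| T (E - H₀)⁻¹_red T |κ⟩` on the product states `|κ⟩ = |κ.1⟩_R ⊗ |κ.2⟩_{R'}`
(`κ ∈ Fin 2 × Fin 2` hole pairs) is the one-bond hard-core boson Hamiltonian
`-J (b†_R b_{R'} + h.c.) + δE(n_R, n_{R'})`: NO entries other than the diagonal (second-order shifts) and the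
exchange pair `((1,0),(0,1))`, `((0,1),(1,0))` (pair hopping `-J`). This file PROVES exactly that:

* `plaquetteStates_isNParticle`: `|0h⟩`, `|2h⟩` carry `4` and `2` electrons;
* `plaquetteKernel_offBlock_eq_zero` (EVERY `U`, every bond set `W`, ANY states of the sectors `(4,·)`, `(2,·)`): the
  ten entries `(κ', κ)` with `κ' ≠ κ` and `{κ', κ} ≠ {(1,0),(0,1)}` VANISH — particle-number selection rule
  `interClusterKernel_hamiltonian_eq_zero_of_mem_szSector` of `Literature/…/InterClusterKernelSelectionRules.lean`
  (each of the four second-order processes changes the plaquette charges by a definite amount; e.g.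
  `⟨0h,0h| T S T |2h,2h⟩` would need a charge transfer of `4`);
* `plaquetteKernel_apply` (`U ∈ [2, 4]`): the complete table
  `K(κ', κ) = if κ' = κ then δE(κ) else if κ = κ'.swap ∧ κ'.1 ≠ κ'.2 then -J(U) else 0` with REAL `δE(κ) = Re K(κ,κ)`
  (`plaquetteKernel_diag_im`) and the real pair hopping `-J(U)` (`plaquetteKernel_hop_eq_neg_J` of `…KernelSymmetry`);
* `plaquetteKernelV_apply` (`U ∈ [2, 4]`): the SAME table for two vertically adjacent plaquettes (bonds
  `plaquetteBondsV`) — isotropy (`plaquetteKernel_vertical_diag/_hop`).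

Together with `plaquetteKernel_diag_decomposition` (`δE(n,n') = δE(0,0) + μ n + μ' n' + V n n'`, with `μ = μ'` by
`plaquettePairCouplings_mu_symm`) this is the statement that, bond by bond, Kato's kernel on the plaquette-product
manifold is `-J Σ (b†b' + h.c.) + V Σ n n' + (2μ per bond end) N_b + const = 2J · XXZ(Δ_eff) + k(N_b)`
(`-2J Δ_eff = V`); the torus-level assembly (embedding `Φ`, sector exhaustion, the two-cluster identification of
`interClusterKernel`) is the rest of stub 2.

Registered sub-goal stub (signature verbatim at the end): `dressHalfFilled_kernelTable`.

Sources: W.-F. Tsai, S. A. Kivelson, PRB 73 (2006) 214510, App. A (A1)–(A3) [TsaiKivelson2006]; H. Yao, W.-F. Tsai,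
S. A. Kivelson, PRB 76 (2007) 161104(R), eq. (2) [YaoTsaiKivelson2007]. No definition and no named fact is introduced.
-/

noncomputable section

set_option linter.dupNamespace false

namespace Summit.HubbardSuperconductivity.HubbardSuperconductivity.Theorems.LevyLogBootstrap

open Matrix Finset Literature.MathematicalPhysics.QuantumLattice Literature.Probability.LatticeModels
open scoped ComplexOrder

section KernelStructure

variable {U : ℝ}

/-! ### Charges of the plaquette states and the vanishing entries (every `U`) -/

/-- The plaquette states carry `4 - 2k` electrons: `|0h⟩` four, `|2h⟩` two. [folklore] -/
theorem plaquetteStates_isNParticle (U : ℝ) (k : Fin 2) :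
    IsNParticle (4 - 2 * (k : ℕ)) (plaquetteStates U k) :=
  isNParticle_of_mem_szSector (plaquetteStates_spec U k).2.1

/-- **The ten off-block entries of Kato's two-plaquette kernel vanish** — for EVERY `U`, every inter-plaquette bond
set `W` and ANY cluster states `φ 0 ∈ (4, m₀)`, `φ 1 ∈ (2, m₁)`: if `κ' ≠ κ` and `{κ', κ}` is not the exchange pair
`{(1,0), (0,1)}` then `⟨κ'| T (E - H₀)⁻¹_red T |κ⟩ = 0`. Particle-number selection rule: a pair transfer changes
the two plaquette charges by `∓2, ±2`, an out-and-back process by `0, 0`; no other charge pattern occurs at second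
order. [cite: TsaiKivelson2006, App. A (A1)–(A3)] -/
theorem plaquetteKernel_offBlock_eq_zero (U : ℝ) {φ : Fin 2 → Fock (Orb PlaquetteSite)} {m : Fin 2 → ℝ}
    (hφ : ∀ k : Fin 2, φ k ∈ szSector (4 - 2 * (k : ℕ)) (m k)) (W : Orb PlaquetteSite → Orb PlaquetteSite → ℝ)
    (κ' κ : Fin 2 × Fin 2) (hne : κ' ≠ κ) (hx : ¬ (κ'.1 ≠ κ'.2 ∧ κ = κ'.swap)) :
    interClusterKernel (plaquetteHamiltonian_isHermitian U) φ W κ' κ = 0 := by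
  refine interClusterKernel_hamiltonian_eq_zero_of_mem_szSector plaquetteGraph 1 U
    (plaquetteHamiltonian_isHermitian U) φ (fun k : Fin 2 => 4 - 2 * (k : ℕ)) m hφ W κ' κ ?_ ?_ ?_
  all_goals
    revert hne hx
    rcases κ' with ⟨a, b⟩
    rcases κ with ⟨c, d⟩
    fin_cases a <;> fin_cases b <;> fin_cases c <;> fin_cases d <;> decide

/-- The vanishing entries of `plaquetteKernel U` itself (the chosen states, horizontal bonds), every `U`.
[cite: TsaiKivelson2006, App. A (A1)–(A3)] -/
theorem plaquetteKernel_eq_zero (U : ℝ) (κ' κ : Fin 2 × Fin 2) (hne : κ' ≠ κ)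
    (hx : ¬ (κ'.1 ≠ κ'.2 ∧ κ = κ'.swap)) : plaquetteKernel U κ' κ = 0 :=
  plaquetteKernel_offBlock_eq_zero U (fun k : Fin 2 => (plaquetteStates_spec U k).2.1) (bondHopping plaquetteBonds)
    κ' κ hne hx

/-- The vanishing entries of the VERTICAL kernel (chosen states, bonds `plaquetteBondsV`), every `U`.
[cite: TsaiKivelson2006, App. A (A1)–(A3)] -/
theorem plaquetteKernelV_eq_zero (U : ℝ) (κ' κ : Fin 2 × Fin 2) (hne : κ' ≠ κ)
    (hx : ¬ (κ'.1 ≠ κ'.2 ∧ κ = κ'.swap)) :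
    interClusterKernel (plaquetteHamiltonian_isHermitian U) (plaquetteStates U) (bondHopping plaquetteBondsV) κ' κ =
      0 :=
  plaquetteKernel_offBlock_eq_zero U (fun k : Fin 2 => (plaquetteStates_spec U k).2.1) (bondHopping plaquetteBondsV)
    κ' κ hne hx

/-! ### The complete table for `U ∈ [2, 4]` -/

/-- A diagonal entry is the real number `Re K(κ, κ)`. [folklore] -/
theorem plaquetteKernel_diag_eq_re (U : ℝ) (κ : Fin 2 × Fin 2) :
    plaquetteKernel U κ κ = (((plaquetteKernel U κ κ).re : ℝ) : ℂ) :=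
  Complex.ext (by rw [Complex.ofReal_re]) (by rw [Complex.ofReal_im, plaquetteKernel_diag_im])

/-- The two exchange entries are both `-J(U)`, `U ∈ [2, 4]`. [cite: YaoTsaiKivelson2007, eq. (2)] -/
theorem plaquetteKernel_exchange_eq_neg_J (hU : U ∈ Set.Icc (2 : ℝ) 4) (κ' : Fin 2 × Fin 2) (h : κ'.1 ≠ κ'.2) :
    plaquetteKernel U κ' κ'.swap = -(((plaquettePairCouplings U).J : ℝ) : ℂ) := by
  rcases κ' with ⟨a, b⟩
  fin_cases a <;> fin_cases b
  · exact absurd rfl h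
  · exact plaquetteKernel_hop'_eq_neg_J hU
  · exact plaquetteKernel_hop_eq_neg_J hU
  · exact absurd rfl h

/-- **THE TWO-PLAQUETTE KERNEL IS THE ONE-BOND HARD-CORE BOSON HAMILTONIAN**, `U ∈ [2, 4]`: the complete `4 × 4`
table of Kato's second-order kernel on the product states of two horizontally adjacent plaquettes,
`K(κ', κ) = if κ' = κ then δE(κ) else if (κ'.1 ≠ κ'.2 ∧ κ = κ'.swap) then -J(U) else 0`,
with real diagonal shifts `δE(κ) = Re K(κ, κ)` and the real pair hopping `-J(U)`: i.e.
`K = -J (b†_R b_{R'} + b†_{R'} b_R) + δE(n_R, n_{R'})` on `{0,1 hole pairs}²` (Yao–Tsai–Kivelson 2007, eq. (2), one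
bond). [cite: YaoTsaiKivelson2007, eq. (2)] -/
theorem plaquetteKernel_apply (hU : U ∈ Set.Icc (2 : ℝ) 4) (κ' κ : Fin 2 × Fin 2) :
    plaquetteKernel U κ' κ =
      if κ' = κ then (((plaquetteKernel U κ κ).re : ℝ) : ℂ)
      else if κ'.1 ≠ κ'.2 ∧ κ = κ'.swap then -(((plaquettePairCouplings U).J : ℝ) : ℂ) else 0 := by
  by_cases h1 : κ' = κ
  · subst h1
    rw [if_pos rfl]
    exact plaquetteKernel_diag_eq_re U κ'
  · rw [if_neg h1]
    by_cases h2 : κ'.1 ≠ κ'.2 ∧ κ = κ'.swap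
    · rw [if_pos h2, h2.2]
      exact plaquetteKernel_exchange_eq_neg_J hU κ' h2.1
    · rw [if_neg h2]
      exact plaquetteKernel_eq_zero U κ' κ h1 h2

/-- **The same table for two VERTICALLY adjacent plaquettes** (bonds `plaquetteBondsV`), `U ∈ [2, 4]`: diagonal
`= Re K(κ,κ)` of the HORIZONTAL kernel, exchange `= -J(U)`, zero elsewhere — the boson model is isotropic bond by
bond. [cite: YaoTsaiKivelson2007, eq. (2)] -/
theorem plaquetteKernelV_apply (hU : U ∈ Set.Icc (2 : ℝ) 4) (κ' κ : Fin 2 × Fin 2) :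
    interClusterKernel (plaquetteHamiltonian_isHermitian U) (plaquetteStates U) (bondHopping plaquetteBondsV) κ' κ =
      if κ' = κ then (((plaquetteKernel U κ κ).re : ℝ) : ℂ)
      else if κ'.1 ≠ κ'.2 ∧ κ = κ'.swap then -(((plaquettePairCouplings U).J : ℝ) : ℂ) else 0 := by
  by_cases h1 : κ' = κ
  · subst h1
    rw [if_pos rfl, plaquetteKernel_vertical_diag hU κ']
    exact plaquetteKernel_diag_eq_re U κ'
  · rw [if_neg h1]
    by_cases h2 : κ'.1 ≠ κ'.2 ∧ κ = κ'.swap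
    · rw [if_pos h2, h2.2]
      rcases κ' with ⟨a, b⟩
      have hab : a ≠ b := h2.1
      fin_cases a <;> fin_cases b
      · exact absurd rfl hab
      · -- `K_V((0,1),(1,0)) = conj K_V((1,0),(0,1)) = conj (-J) = -J`
        have h := star_interClusterKernel (plaquetteHamiltonian_isHermitian U) (plaquetteStates U)
          (bondHopping plaquetteBondsV) ((1 : Fin 2), (0 : Fin 2)) ((0 : Fin 2), (1 : Fin 2))
        rw [plaquetteKernel_vertical_hop hU, star_neg, Complex.star_def, Complex.conj_ofReal] at h
        exact h.symm
      · exact plaquetteKernel_vertical_hop hU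
      · exact absurd rfl hab
    · rw [if_neg h2]
      exact plaquetteKernelV_eq_zero U κ' κ h1 h2

end KernelStructure

/-! ### Registered sub-goal stub of stmt-HubbardSuperconductivity-8148 (signature verbatim) -/

/-- Registered sub-goal `dressHalfFilled_kernelTable` (stub-2 groundwork, one bond of clause (d)): for `U ∈ [2,4]`
Kato's two-plaquette kernel is the one-bond hard-core boson Hamiltonian — diagonal real shifts, real pair hopping
`-J(U)` on the exchange pair, all other entries zero. [cite: YaoTsaiKivelson2007, eq. (2)] -/
theorem dressHalfFilled_kernelTable : ∀ {U : ℝ}, U ∈ Set.Icc (2 : ℝ) 4 → ∀ κ' κ : Fin 2 × Fin 2, Literature.MathematicalPhysics.QuantumLattice.plaquetteKernel U κ' κ = (if κ' = κ then (((Literature.MathematicalPhysics.QuantumLattice.plaquetteKernel U κ κ).re : ℝ) : ℂ) else if κ'.1 ≠ κ'.2 ∧ κ = κ'.swap then -(((Literature.MathematicalPhysics.QuantumLattice.plaquettePairCouplings U).J : ℝ) : ℂ) else 0) :=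
  fun hU κ' κ => plaquetteKernel_apply hU κ' κ

end Summit.HubbardSuperconductivity.HubbardSuperconductivity.Theorems.LevyLogBootstrap

end
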